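import Mathlib
import HarnessLib
import Summits.BirchSwinnertonDyer.BirchSwinnertonDyer.Theses.ManinLocalTwoThree
import Summits.BirchSwinnertonDyer.Rank1Residual.ManinAdditive.TwistOrbitDegreeIdentity
import Literature.NumberTheory.EllipticCurves.ManinConstantClassCertificateTwistGamma0Proofs
import Literature.NumberTheory.EllipticCurves.ModularCurveNonempty
import Literature.NumberTheory.EllipticCurves.IsogenyIdProofs
import Literature.NumberTheory.EllipticCurves.GaloisAction

/-!
# Lines/ternary-twist.lean — first REAL skeleton line of crux `ManinPrimeToThreeAtNine` (C3, stmt-22968)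
(route `ManinLocalTwoThree`; planner bsd-f2-manin-imc g8, 2026-08-27; refines the BC3 birth skeleton
`Lines/birth.lean` = {twist-covered, twist-minimal} at `3`; dovetails with line `kato-shift-three` (-es)).

IDEA (slug `ternary-twist`). Partition the optimal classes with `9 ∣ N` by the TERNARY TWIST PREDICATE
«the class of `W` is the `(-3)`-twist of a class semistable at `3`» (all such classes have `v₃(N) = 2`).
* Twist-COVERED half: PROVED in the composition — at an odd prime the tree certificate
  `not_dvd_maninConstant_of_isTwistOfSemistableAt_gamma0` (Stevens (5.2) proved + the printed semistable
  facts, consumed BY NAME = exactly the crux's four hypotheses) has NO `η`-residue; the only input left is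
  `stub_ternaryTwistConductor` = local conductor bookkeeping `N(W′) ∣ N(W)` (`f₃(W′ ⊗ χ₋₃) = 2 ≥ v₃(N(W′))`,
  odd part unchanged; provable, size S–M).
* Twist-MINIMAL core (potentially good at `3` with semistability defect `e₃ ∈ {3, 4, 6, 12}`: the tame
  `e₃ = 4` classes at `v₃(N) = 2` and all of `v₃(N) ∈ {3, 4, 5}`), split by the `E[3]` DICHOTOMY shared with
  line `kato-shift-three`: `stub_twistMinimalAtThree_irreducible` (`ρ̄_{E,3}` irreducible — inside the reach
  of the -es Kato/Ihara shift mechanism: E-es-18 `KatoShiftTwistManinThree` implies it outright) and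
  `stub_twistMinimalAtThree_reducible` (a rational `3`-isogeny — the Eisenstein residue; levers: isogeny
  bookkeeping along the `3`-isogeny à la E-an-31, Γ₁/Γ₀ comparison; no printed theorem).
`ManinPrimeToThreeAtNine_of` is the kernel-checked composition concluding the ROUTE DECL by name.
-/

set_option autoImplicit false
set_option linter.dupNamespace false

noncomputable section

open WeierstrassCurve Literature.NumberTheory.EllipticCurves
  Literature.NumberTheory.EllipticCurves.ModularForms
  Summit.BirchSwinnertonDyer.Rank1Residual.ManinAdditive

namespace Summit.BirchSwinnertonDyer.BirchSwinnertonDyer.Cruxes.ManinPrimeToThreeAtNine.TernaryTwist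

/-- STUB 1 (TERNARY TWIST CONDUCTOR BOOKKEEPING; size S–M; local, true). -/
theorem stub_ternaryTwistConductor :
    exists_isNewformOf →
    ∀ {W : WeierstrassCurve ℚ} [W.IsElliptic] {W' : WeierstrassCurve ℚ} [W'.IsElliptic]
      [W'.IsGloballyMinimal], IsIsogenous W (W'.quadraticTwist ((-3 : ℤ) : ℚ)) →
      ¬ 3 ^ 2 ∣ W'.conductorNorm ℤ →
      (¬ W.HasGoodReductionAtPrime 3 ∧ ¬ W.HasMultiplicativeReductionAtPrime 3) →
      W'.conductorNorm ℤ ∣ W.conductorNorm ℤ := by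
  sorry

/-- STUB 2 (TWIST-MINIMAL CORE AT `3`, `E[3]` IRREDUCIBLE; size L; implied by E-es-18). -/
theorem stub_twistMinimalAtThree_irreducible :
      mazur_not_dvd_maninConstant_of_odd →
      abbesUllmo_not_dvd_maninConstant_of_not_dvd_level →
      cesnavicius_not_two_dvd_maninConstant_of_two_dvd_level →
      exists_isNewformOf →
      ∀ (W : WeierstrassCurve ℚ) [W.IsElliptic] [W.IsGloballyMinimal] {N : ℕ} [NeZero N]
        (D : ModularParametrizationData W N),
        (∀ z ∈ D.L.lattice, ∃ w ∈ periodLattice D.f, z = D.c * w) → 3 ^ 2 ∣ N →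
        ¬ (∃ (W' : WeierstrassCurve ℚ) (d : ℤ), W'.IsElliptic ∧ W'.IsGloballyMinimal ∧
          (d = -3) ∧ IsIsogenous W (W'.quadraticTwist (d : ℚ)) ∧
          ¬ 3 ^ 2 ∣ W'.conductorNorm ℤ) →
        W.HasIrreducibleModPGaloisRep 3 →
        ¬ (3 : ℤ) ∣ D.maninConstant := by
  sorry

/-- STUB 3 (TWIST-MINIMAL CORE AT `3`, `E[3]` REDUCIBLE = rational `3`-isogeny; size XL; the Eisenstein
residue, no printed theorem). -/
theorem stub_twistMinimalAtThree_reducible :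
      mazur_not_dvd_maninConstant_of_odd →
      abbesUllmo_not_dvd_maninConstant_of_not_dvd_level →
      cesnavicius_not_two_dvd_maninConstant_of_two_dvd_level →
      exists_isNewformOf →
      ∀ (W : WeierstrassCurve ℚ) [W.IsElliptic] [W.IsGloballyMinimal] {N : ℕ} [NeZero N]
        (D : ModularParametrizationData W N),
        (∀ z ∈ D.L.lattice, ∃ w ∈ periodLattice D.f, z = D.c * w) → 3 ^ 2 ∣ N →
        ¬ (∃ (W' : WeierstrassCurve ℚ) (d : ℤ), W'.IsElliptic ∧ W'.IsGloballyMinimal ∧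
          (d = -3) ∧ IsIsogenous W (W'.quadraticTwist (d : ℚ)) ∧
          ¬ 3 ^ 2 ∣ W'.conductorNorm ℤ) →
        ¬ W.HasIrreducibleModPGaloisRep 3 →
        ¬ (3 : ℤ) ∣ D.maninConstant := by
  sorry

/-- COMPOSITION (no sorry): the three stubs give the crux BY NAME; the twist-covered half is proved
here from STUB 1 and the tree's odd-prime twist certificate. -/
theorem ManinPrimeToThreeAtNine_of :
    Summit.BirchSwinnertonDyer.BirchSwinnertonDyer.Theses.ManinLocalTwoThree.ManinPrimeToThreeAtNine := by
  intro hM hAU hC hnf W _ _ N _ D hopt h9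
  by_cases hex : (∃ (W' : WeierstrassCurve ℚ) (d : ℤ), W'.IsElliptic ∧ W'.IsGloballyMinimal ∧
      (d = -3) ∧ IsIsogenous W (W'.quadraticTwist (d : ℚ)) ∧ ¬ 3 ^ 2 ∣ W'.conductorNorm ℤ)
  · -- twist-covered: level = conductor (modularity), additivity at 3, bookkeeping, odd-prime certificate.
    haveI : Fact (Nat.Prime 3) := ⟨Nat.prime_three⟩
    have hN : N = W.conductorNorm ℤ :=
      ModularParametrizationData.level_eq_conductorNorm_of_exists hnf D
    have h9W : 3 ^ 2 ∣ W.conductorNorm ℤ := hN ▸ h9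
    have hadd : ¬ W.HasGoodReductionAtPrime 3 ∧ ¬ W.HasMultiplicativeReductionAtPrime 3 :=
      not_good_and_not_mult_of_sq_dvd_conductorNorm W h9W
    obtain ⟨W', d, hW'e, hW'm, hd, htw, h9N'⟩ := hex
    haveI := hW'e
    haveI := hW'm
    subst hd
    have hN'N : W'.conductorNorm ℤ ∣ W.conductorNorm ℤ := stub_ternaryTwistConductor hnf htw h9N' hadd
    have hstar : ((((-1 : ℤ) ^ (3 / 2) * 3 : ℤ)) : ℚ) = ((-3 : ℤ) : ℚ) := by norm_num
    have htw' : IsIsogenous W (W'.quadraticTwist ((((-1 : ℤ) ^ (3 / 2) * 3 : ℤ)) : ℚ)) := by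
      rw [hstar]; exact htw
    exact not_dvd_maninConstant_of_isTwistOfSemistableAt_gamma0 hM hAU hC hnf (q := 3) (by decide)
      htw' hN'N h9W h9N' hadd W D (IsIsogenous.refl_holds W) hopt
  · by_cases hirr : W.HasIrreducibleModPGaloisRep 3
    · exact stub_twistMinimalAtThree_irreducible hM hAU hC hnf W D hopt h9 hex hirr
    · exact stub_twistMinimalAtThree_reducible hM hAU hC hnf W D hopt h9 hex hirr

end Summit.BirchSwinnertonDyer.BirchSwinnertonDyer.Cruxes.ManinPrimeToThreeAtNine.TernaryTwist

end
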